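import Summits.BirchSwinnertonDyer.Rank1Residual.X2.GreenbergVatsalTateDatum
import Summits.BirchSwinnertonDyer.Rank1Residual.Additive.CyclotomicThreeMultiplicativeReduction
import Literature.NumberTheory.EllipticCurves.OrdinaryReductionKernelTorsionProofs
import Literature.NumberTheory.EllipticCurves.KodairaNeronUnramifiedInertiaProofs
import Literature.NumberTheory.EllipticCurves.SelmerFiniteProofs
import HarnessLib

/-!
# The Tate datum of `E/ℚ` at an odd prime `p ‖ N`, split OR non-split: the local inertia group fixes
# `√γ(E)` (`γ = −c₄/c₆` is a `p`-unit), so GV's "`I_p` acts trivially on `D`" and the Kummer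
# compatibility hold, and `Sel_{p^∞}(E/ℚ_∞) ⊆ S^{Σ₀}_{E[p^∞]}(ℚ_∞)` — granted the published Tate
# uniformisation (Silverman *ATAEC* V.5.2–5.4)

HONEST FRAMING (cell `b2b-bsdres`, run/shared/lean/b2b/bsd-rank1-residual/, verbatim in every
file): the goal of the cell is to DELETE the COMBINATION-SHAPED residual classes of the
Birch–Swinnerton-Dyer formula for ALL analytic-rank `≤ 1` elliptic curves over `ℚ` — "full BSD
formula for every rank `≤ 1` curve in class `C`" assembled STRICTLY from published theorems — so
that the rank-`≤ 1` remainder becomes exactly the CONSTRUCTION-SHAPED classes, which are TYPED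
(missing-input `Prop`s), NOT attempted. This is not "finishing BSD". Sub-cell
`b2b-bsdres-eisenstein-p2` (CLASS-OWNERS row "X2"), gen 9: research route; NO CLAIM BEYOND STATED
CLASSES; nothing here changes a label. Theorems only (no `def`, no NEW named fact); the last theorem
is CONDITIONAL on the tree's named fact `Silverman1994_thmV53_corV54_tateUniformisation` (Silverman
*ATAEC* Lemma V.5.2 (c), Thm. V.5.3, Cor. V.5.4 — PUBLISHED; hypothesis `hT`).

WHAT THIS FILE PROVES (the X2 member of a route-G pair: `E/ℚ` globally minimal, `p` ODD, `p ‖ N`):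
* `not_dvd_c₆_of_hasMultiplicativeReductionAtPrime` — `p ∤ c₆(E_ℤ)` (with `p ∣ Δ_min`, `p ∤ c₄` from
  the tree's `Additive.dvd_and_not_dvd_c₄_of_hasMultiplicativeReductionAtPrime`, Silverman VII.5.1(b),
  and `1728Δ = c₄³ − c₆²`);
* **`inertia_fix_sqrt_gamma`** — the hypothesis `ht` of
  `GreenbergVatsalTateDatum.exists_datum_of_hasMultiplicativeReductionAt` DISCHARGED over `ℚ`: every
  `t ∈ K̄_v` with `t² = γ = −c₄/c₆` is fixed by the local inertia group (`|γ|_v = 1` so `|t|_v = 1`;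
  `σt = ±t`; `σt = −t` would give `|σt − t|_v = |2|_v = 1`, contradicting `|σz − z|_v < 1` on
  integers for `σ` in the inertia group, Neukirch II (9.3) — `p` odd). I.e. `ℚ_v(√γ)/ℚ_v` is
  unramified (trivial when split) — Silverman *ATAEC* V Ex. 5.11 in the one direction needed;
* **`exists_data_selmerInfty_le_gvSelmerInfty_rat`** — for ANY `ℤ_p`-extension `κ` of `ℚ` and any
  `Σ₀ ⊇` bad primes `≠ p`: Tate data `L` above `p` with GV's `htriv` and
  `WeierstrassCurve.selmerInfty κ ≤ gvSelmerInfty κ E[p^∞] L Σ₀` — the dual link (referee R102.2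
  (b)) for the MULTIPLICATIVE member, split or non-split, conditional only on the Tate uniformisation.

References: Greenberg–Vatsal 2000, §2 pp. 14–15, 19; Silverman, *ATAEC* Ch. V Lemma 5.2, Thm. 5.3,
Cor. 5.4, Ex. 5.11; Silverman, *AEC* VII.5.1(b); Neukirch, *ANT* II (9.3).
-/

noncomputable section

open scoped Classical AddSubgroup NNReal

open NumberField IsDedekindDomain Field
open Literature.NumberTheory.EllipticCurves Literature.NumberTheory.EllipticCurves.GreenbergSelmer
  Literature.NumberTheory.GaloisRepresentations IsDedekindDomain.HeightOneSpectrum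
  Summit.BirchSwinnertonDyer.Rank1Residual.X2.GreenbergVatsalTorsion
  Summit.BirchSwinnertonDyer.Rank1Residual.X2.GreenbergVatsalTateDatum
open WeierstrassCurve (minimalDiscriminantInt integralModelInt)

namespace Summit.BirchSwinnertonDyer.Rank1Residual.X2.GreenbergVatsalTateDatumRat

variable (W : WeierstrassCurve ℚ) [W.IsElliptic] [W.IsGloballyMinimal] {p : ℕ} [hp : Fact p.Prime]
  {v : HeightOneSpectrum (𝓞 ℚ)}

/-- **At a prime of multiplicative reduction `p ∤ c₆(E_ℤ)`** (globally minimal `E/ℚ`): `p ∣ Δ_min`,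
`p ∤ c₄` (Silverman VII.5.1(b), tree `dvd_and_not_dvd_c₄_of_hasMultiplicativeReductionAtPrime`) and
`1728Δ = c₄³ − c₆²`. [cite: SilvermanAEC2009, VII.5 Prop. 5.1(b)] -/
theorem not_dvd_c₆_of_hasMultiplicativeReductionAtPrime (hmult : W.HasMultiplicativeReductionAtPrime p) :
    ¬ (p : ℤ) ∣ (integralModelInt W).c₆ := by
  obtain ⟨hΔ, hc₄⟩ := Additive.dvd_and_not_dvd_c₄_of_hasMultiplicativeReductionAtPrime W p hmult
  intro h6
  have hp' : Prime (p : ℤ) := Nat.prime_iff_prime_int.mp hp.out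
  have hrel : (integralModelInt W).c₄ ^ 3 =
      1728 * (integralModelInt W).Δ + (integralModelInt W).c₆ ^ 2 := by
    rw [(integralModelInt W).c_relation]; ring
  have h3 : (p : ℤ) ∣ (integralModelInt W).c₄ ^ 3 := by
    rw [hrel]
    exact dvd_add (dvd_mul_of_dvd_right hΔ _) (dvd_pow h6 two_ne_zero)
  exact hc₄ (hp'.dvd_of_dvd_pow h3)

/-- **The local inertia group fixes `t = √γ(E)`, `γ = −c₄/c₆`, at an ODD prime `p` of multiplicative
reduction of the globally minimal `E/ℚ`** (hypothesis `ht` of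
`GreenbergVatsalTateDatum.exists_datum_of_hasMultiplicativeReductionAt`; Silverman *ATAEC* V §5,
Ex. 5.11: `K_v(√γ)/K_v` is unramified — trivial in the split case): `c₄`, `c₆` are `p`-units, so
`|γ|_v = 1` and `|t|_v = 1`; for `σ` in the inertia group `|σt − t|_v < 1` (Neukirch II (9.3)), while
`σt = ±t` (`(σt)² = σ(γ) = γ`) and `σt = −t` would give `|σt − t|_v = |2t|_v = 1` (`p` odd).
[cite: SilvermanATAEC1994, Ch. V Lemma 5.2 (c), Thm. 5.3 (a),(b), Cor. 5.4 (held copy PDF pp. 406–410)]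
[cite: SilvermanAEC2009, VII.5 Prop. 5.1(b)] -/
theorem inertia_fix_sqrt_gamma (hp2 : p ≠ 2) (hmult : W.HasMultiplicativeReductionAtPrime p)
    (hpv : ((p : ℕ) : 𝓞 ℚ) ∈ v.asIdeal) :
    ∀ t : AlgebraicClosure (v.adicCompletion ℚ),
      t ^ 2 = algebraMap (v.adicCompletion ℚ) (AlgebraicClosure (v.adicCompletion ℚ))
        (algebraMap ℚ (v.adicCompletion ℚ) (-(W.c₄ / W.c₆))) →
      ∀ σ ∈ absInertia (v.adicCompletion ℚ),
        Field.absoluteGaloisGroup.toAlgEquiv (v.adicCompletion ℚ) σ t = t := by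
  intro t ht σ hσ
  obtain ⟨w, hw⟩ := v.exists_spectralValuation
  obtain ⟨-, hc₄⟩ := Additive.dvd_and_not_dvd_c₄_of_hasMultiplicativeReductionAtPrime W p hmult
  have hc₆ := not_dvd_c₆_of_hasMultiplicativeReductionAtPrime W hmult
  -- `γ` in `K̄_v`
  have h4 : W.c₄ = ((integralModelInt W).c₄ : ℚ) := by
    conv_lhs => rw [← WeierstrassCurve.map_integralModelInt W]
    rw [WeierstrassCurve.map_c₄, eq_intCast]
  have h6 : W.c₆ = ((integralModelInt W).c₆ : ℚ) := by
    conv_lhs => rw [← WeierstrassCurve.map_integralModelInt W]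
    rw [WeierstrassCurve.map_c₆, eq_intCast]
  have hγ : algebraMap (v.adicCompletion ℚ) (AlgebraicClosure (v.adicCompletion ℚ))
      (algebraMap ℚ (v.adicCompletion ℚ) (-(W.c₄ / W.c₆))) =
      -((((integralModelInt W).c₄ : ℤ) : AlgebraicClosure (v.adicCompletion ℚ)) /
        (((integralModelInt W).c₆ : ℤ) : AlgebraicClosure (v.adicCompletion ℚ))) := by
    rw [← IsScalarTower.algebraMap_apply ℚ (v.adicCompletion ℚ)
      (AlgebraicClosure (v.adicCompletion ℚ)), h4, h6, map_neg, map_div₀, map_intCast, map_intCast]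
  have hw4 : w (((integralModelInt W).c₄ : ℤ) : AlgebraicClosure (v.adicCompletion ℚ)) = 1 :=
    spectralValuation_intCast_eq_one_of_natCast_mem hpv hw hc₄
  have hw6 : w (((integralModelInt W).c₆ : ℤ) : AlgebraicClosure (v.adicCompletion ℚ)) = 1 :=
    spectralValuation_intCast_eq_one_of_natCast_mem hpv hw hc₆
  have hwt2 : w t ^ 2 = 1 := by
    rw [← map_pow, ht, hγ, Valuation.map_neg, map_div₀, hw4, hw6, div_one]
  have hwt : w t = 1 := by
    rcases lt_trichotomy (w t) 1 with h | h | h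
    · exact absurd hwt2 (ne_of_lt (pow_lt_one₀ zero_le h two_ne_zero))
    · exact h
    · exact absurd hwt2 (ne_of_gt (one_lt_pow₀ h two_ne_zero))
  -- inertia moves `t` by less than `1`
  obtain ⟨𝔐, h𝔐⟩ := v.localPrimesAbove_nonempty
  have hσ' : σ ∈ 𝔐.inertia (absoluteGaloisGroup (v.adicCompletion ℚ)) := by
    rw [inertia_eq_absInertia hw h𝔐]; exact hσ
  have hlt : w (σ • t - t) < 1 := (mem_inertia_iff_spectralValuation hw h𝔐).1 hσ' t hwt.le
  -- `(σ t)² = t²`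
  have hsq : (σ • t) ^ 2 = t ^ 2 := by
    rw [Field.absoluteGaloisGroup.smul_def, ← map_pow, ht, AlgEquiv.commutes]
  have hcases : σ • t = t ∨ σ • t = -t := by
    have h0 : (σ • t - t) * (σ • t + t) = 0 := by
      have : (σ • t - t) * (σ • t + t) = (σ • t) ^ 2 - t ^ 2 := by ring
      rw [this, hsq, sub_self]
    rcases mul_eq_zero.mp h0 with h | h
    · exact Or.inl (sub_eq_zero.mp h)
    · exact Or.inr (eq_neg_of_add_eq_zero_left h)
  rcases hcases with h | h
  · exact h
  · exfalso
    have h2 : ¬ (p : ℤ) ∣ (-2 : ℤ) := by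
      rw [Int.dvd_neg]
      intro hd
      have : p ∣ 2 := by exact_mod_cast hd
      exact hp2 ((Nat.prime_dvd_prime_iff_eq hp.out Nat.prime_two).mp this)
    have hw2 : w (((-2 : ℤ)) : AlgebraicClosure (v.adicCompletion ℚ)) = 1 :=
      spectralValuation_intCast_eq_one_of_natCast_mem hpv hw h2
    have hrew : σ • t - t = (((-2 : ℤ)) : AlgebraicClosure (v.adicCompletion ℚ)) * t := by
      rw [h]; push_cast; ring
    rw [hrew, map_mul, hw2, hwt, one_mul] at hlt
    exact lt_irrefl _ hlt

/-- **The dual link at `p ‖ N` over `ℚ`, split OR non-split** (referee R102.2 (b), multiplicative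
member of a route-G pair): for a globally minimal `E/ℚ`, an odd prime `p` of multiplicative
reduction, any `ℤ_p`-extension `κ` and any `Σ₀ ⊇` bad primes `≠ p`, there are Tate data `L` above `p`
satisfying GV's "`I_p` acts trivially on `D`" with `Sel_{p^∞}(E/ℚ_∞) ⊆ S^{Σ₀}_{E[p^∞]}(ℚ_∞)` —
granted the PUBLISHED twisted Tate uniformisation (`hT`, Silverman *ATAEC* V.5.2–5.4; named fact
`Silverman1994_thmV53_corV54_tateUniformisation`); the unramifiedness input `ht` is DISCHARGED by
`inertia_fix_sqrt_gamma`. [cite: GreenbergVatsal2000, §2 p. 19 (6) and pp. 14–15]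
[cite: SilvermanATAEC1994, Ch. V Lemma 5.2 (c), Thm. 5.3 (a),(b), Cor. 5.4 (held copy PDF pp. 406–410)] -/
theorem exists_data_selmerInfty_le_gvSelmerInfty_rat (κ : ZpExtension ℚ p)
    (S₀ : Set (HeightOneSpectrum (𝓞 ℚ)))
    (hT : Silverman1994_thmV53_corV54_tateUniformisation.{0}) (hp2 : p ≠ 2)
    (hmult : W.HasMultiplicativeReductionAtPrime p)
    (hS : ∀ v : HeightOneSpectrum (𝓞 ℚ), v ∉ S₀ → ((p : ℕ) : 𝓞 ℚ) ∉ v.asIdeal →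
      W.HasGoodReductionAt v) :
    ∃ L : Data ℚ (W.geomPrimaryTorsion p) p,
      (∀ (v : HeightOneSpectrum (𝓞 ℚ)) (hv : ((p : ℕ) : 𝓞 ℚ) ∈ v.asIdeal),
        ∀ x ∈ inertia v, ∀ m : W.geomPrimaryTorsion p, x • m - m ∈ (L v hv).plus) ∧
      W.selmerInfty κ ≤ gvSelmerInfty κ (W.geomPrimaryTorsion p) L S₀ := by
  have hmultv : ∀ v : HeightOneSpectrum (𝓞 ℚ), ((p : ℕ) : 𝓞 ℚ) ∈ v.asIdeal →
      W.HasMultiplicativeReductionAt v := by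
    intro v hv
    have hvp : (Rat.HeightOneSpectrum.primesEquiv v : ℕ) = p :=
      Rat.HeightOneSpectrum.primesEquiv_eq_of_natCast_mem v hp.out hv
    have h := W.hasMultiplicativeReductionAtPrime_iff_hasMultiplicativeReductionAt_ringOfIntegers v
    subst hvp
    exact h.mp hmult
  exact exists_data_selmerInfty_le_gvSelmerInfty_of_multiplicative W p S₀ κ hT hS
    hmultv (fun v hv ↦ inertia_fix_sqrt_gamma W hp2 hmult hv)

end Summit.BirchSwinnertonDyer.Rank1Residual.X2.GreenbergVatsalTateDatumRat

end
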